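import Summits.PneNP.PneNP.Theses.RamseyThreshold

/-!
# Route RamseyThreshold — combinatorics of the `K₄`-non-arrowing verifier (helper for `NonArrowingMemNP`, stmt-PneNP-2055)

A 2-colouring `c` of the vertex pairs of `G` leaves no `K₄` of `G` monochromatic iff for every increasing quadruple
`i < j < k < m` of pairwise adjacent vertices the six colours `c{i,j}, …, c{k,m}` are not all equal. The two directions,
with the colouring given on ordered pairs (`col u v`, read at `u < v`) as the verifier sees it.
-/

set_option linter.dupNamespace false -- `Summit.PneNP.PneNP.…`: summit = sub-problem name (D-0017 single-conjunct layout)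

namespace Summit.PneNP.PneNP.Theorems

/-- **Soundness of the quadruple test.** If no increasing adjacent quadruple has its six (ordered-pair) colours all equal,
the symmetric colouring `{u, v} ↦ col (min u v) (max u v)` leaves no `K₄` monochromatic. [folklore] -/
theorem ramseyThreshold_nonArrowing_of_quadruples {n : ℕ} (G : SimpleGraph (Fin n)) (col : ℕ → ℕ → Bool)
    (H : ∀ i j k m : Fin n, i < j → j < k → k < m → G.Adj i j → G.Adj i k → G.Adj i m → G.Adj j k → G.Adj j m → G.Adj k m →
      ¬ (col i j = col i k ∧ col i j = col i m ∧ col i j = col j k ∧ col i j = col j m ∧ col i j = col k m)) :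
    ∃ c : Sym2 (Fin n) → Bool, ∀ S : Finset (Fin n), G.IsNClique 4 S → ∀ b : Bool, ∃ u ∈ S, ∃ v ∈ S, u ≠ v ∧ c s(u, v) ≠ b := by
  classical
  refine ⟨Sym2.lift ⟨fun u v : Fin n => col ((min u v : Fin n) : ℕ) ((max u v : Fin n) : ℕ), fun u v => by
    simp only [min_comm, max_comm]⟩, fun S hS b => ?_⟩
  -- the four vertices in increasing order
  have hlen : (S.sort).length = 4 := by rw [Finset.length_sort, hS.card_eq]
  have hsort := Finset.sortedLT_sort S
  rw [List.sortedLT_iff_pairwise] at hsort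
  have hmem : ∀ a, a ∈ S.sort ↔ a ∈ S := fun a => Finset.mem_sort _
  rcases hq : S.sort with _ | ⟨i, _ | ⟨j, _ | ⟨k, _ | ⟨m, _ | ⟨e, t⟩⟩⟩⟩⟩ <;> rw [hq] at hlen <;>
    simp only [List.length_cons, List.length_nil] at hlen <;> try omega
  rw [hq] at hsort hmem
  simp only [List.pairwise_cons, List.mem_cons, List.not_mem_nil, or_false, forall_eq_or_imp, forall_eq,
    List.Pairwise.nil, and_true, IsEmpty.forall_iff, imp_true_iff] at hsort
  obtain ⟨⟨hij, hik, him⟩, ⟨hjk, hjm⟩, hkm⟩ := hsort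
  have hiS : i ∈ S := (hmem i).1 (by simp)
  have hjS : j ∈ S := (hmem j).1 (by simp)
  have hkS : k ∈ S := (hmem k).1 (by simp)
  have hmS : m ∈ S := (hmem m).1 (by simp)
  have hadj : ∀ {u v : Fin n}, u ∈ S → v ∈ S → u < v → G.Adj u v := fun hu hv huv => hS.isClique hu hv (ne_of_lt huv)
  have key := H i j k m hij hjk hkm (hadj hiS hjS hij) (hadj hiS hkS hik) (hadj hiS hmS him) (hadj hjS hkS hjk)
    (hadj hjS hmS hjm) (hadj hkS hmS hkm)
  -- the value of the symmetric colouring on an increasing pair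
  have hval : ∀ {u v : Fin n}, u < v →
      Sym2.lift ⟨fun u v : Fin n => col ((min u v : Fin n) : ℕ) ((max u v : Fin n) : ℕ), fun u v => by
        simp only [min_comm, max_comm]⟩ s(u, v) = col u v := by
    intro u v huv
    rw [Sym2.lift_mk]
    simp only [min_eq_left huv.le, max_eq_right huv.le]
  -- a pair of colour `≠ b`
  have pick : ∀ {u v : Fin n}, u ∈ S → v ∈ S → u < v → col u v ≠ b → ∃ u ∈ S, ∃ v ∈ S, u ≠ v ∧
      Sym2.lift ⟨fun u v : Fin n => col ((min u v : Fin n) : ℕ) ((max u v : Fin n) : ℕ), fun u v => by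
        simp only [min_comm, max_comm]⟩ s(u, v) ≠ b :=
    fun hu hv huv h => ⟨_, hu, _, hv, ne_of_lt huv, by rwa [hval huv]⟩
  by_cases hb : col i j = b
  · rw [hb] at key
    simp only [not_and_or] at key
    rcases key with h | h | h | h | h
    · exact pick hiS hkS hik (Ne.symm h)
    · exact pick hiS hmS him (Ne.symm h)
    · exact pick hjS hkS hjk (Ne.symm h)
    · exact pick hjS hmS hjm (Ne.symm h)
    · exact pick hkS hmS hkm (Ne.symm h)
  · exact pick hiS hjS hij hb

/-- **Completeness of the quadruple test.** A colouring of the pairs leaving no `K₄` monochromatic gives six colours that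
are not all equal on every increasing adjacent quadruple. [folklore] -/
theorem ramseyThreshold_quadruples_of_nonArrowing {n : ℕ} (G : SimpleGraph (Fin n)) (c : Sym2 (Fin n) → Bool)
    (hc : ∀ S : Finset (Fin n), G.IsNClique 4 S → ∀ b : Bool, ∃ u ∈ S, ∃ v ∈ S, u ≠ v ∧ c s(u, v) ≠ b)
    (i j k m : Fin n) (hij : i < j) (hjk : j < k) (hkm : k < m) (aij : G.Adj i j) (aik : G.Adj i k) (aim : G.Adj i m)
    (ajk : G.Adj j k) (ajm : G.Adj j m) (akm : G.Adj k m) :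
    ¬ (c s(i, j) = c s(i, k) ∧ c s(i, j) = c s(i, m) ∧ c s(i, j) = c s(j, k) ∧ c s(i, j) = c s(j, m) ∧ c s(i, j) = c s(k, m)) := by
  classical
  intro hall
  have hik : i < k := hij.trans hjk
  have him : i < m := hik.trans hkm
  have hjm : j < m := hjk.trans hkm
  -- `{i, j, k, m}` is a `K₄` of `G`
  have hcl : G.IsNClique 4 {i, j, k, m} := by
    rw [SimpleGraph.isNClique_iff]
    constructor
    · rw [Finset.coe_insert, Finset.coe_insert, Finset.coe_insert, Finset.coe_singleton, SimpleGraph.isClique_insert,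
        SimpleGraph.isClique_insert, SimpleGraph.isClique_insert]
      refine ⟨⟨⟨SimpleGraph.isClique_singleton m, ?_⟩, ?_⟩, ?_⟩
      · intro b hb _; rw [Set.mem_singleton_iff] at hb; subst hb; exact akm
      · intro b hb _
        simp only [Set.mem_insert_iff, Set.mem_singleton_iff] at hb
        rcases hb with rfl | rfl
        · exact ajk
        · exact ajm
      · intro b hb _
        simp only [Set.mem_insert_iff, Set.mem_singleton_iff] at hb
        rcases hb with rfl | rfl | rfl
        · exact aij
        · exact aik
        · exact aim
    · rw [Finset.card_insert_of_notMem (by simp [hij.ne, hik.ne, him.ne]), Finset.card_insert_of_notMem (by simp [hjk.ne, hjm.ne]),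
        Finset.card_pair hkm.ne]
  obtain ⟨u, hu, v, hv, huv, hne⟩ := hc _ hcl (c s(i, j))
  obtain ⟨h1, h2, h3, h4, h5⟩ := hall
  simp only [Finset.mem_insert, Finset.mem_singleton] at hu hv
  apply hne
  rcases hu with rfl | rfl | rfl | rfl <;> rcases hv with rfl | rfl | rfl | rfl <;>
    first
    | exact absurd rfl huv
    | rfl
    | exact h1.symm
    | exact h2.symm
    | exact h3.symm
    | exact h4.symm
    | exact h5.symm
    | exact congrArg c Sym2.eq_swap
    | exact (congrArg c Sym2.eq_swap).trans h1.symm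
    | exact (congrArg c Sym2.eq_swap).trans h2.symm
    | exact (congrArg c Sym2.eq_swap).trans h3.symm
    | exact (congrArg c Sym2.eq_swap).trans h4.symm
    | exact (congrArg c Sym2.eq_swap).trans h5.symm

end Summit.PneNP.PneNP.Theorems
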